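import Summits.BirchSwinnertonDyer.Rank1Residual.X10.ResidualSelmerParityInstance
import HarnessLib

/-!
# The `E[p]` instance of the N2 parity law, PART X — the GENERATOR TESTS (G) for `H¹(K, E[p])`
# at one exceptional place, and the fact-free weak form
# (cell `b2b-bsdres`, unit `b2b-bsdres-x10` = N2 class lead, GEN 31; theorems only, no definition,
# ONE named-fact hypothesis `poitouTate_selmerStructure_duality K` in §1 (→ conditional), §2 fact-free)

HONEST FRAMING (run/shared/lean/b2b/bsd-rank1-residual/, verbatim in every file): the goal of the
cell is to DELETE the COMBINATION-SHAPED residual classes of the Birch–Swinnerton-Dyer formula for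
ALL analytic-rank `≤ 1` elliptic curves over `ℚ` — "full BSD formula for every rank `≤ 1` curve in
class `C`" assembled STRICTLY from published theorems — so that the rank-`≤ 1` remainder becomes
exactly the CONSTRUCTION-SHAPED classes, which are TYPED (missing-input `Prop`s), NOT attempted.
This is not "finishing BSD". Class X10b (= N2) keeps its label CONSTRUCTION-SHAPED (NEEDS `X_A3`,
referee R82.3 / RESIDUAL-MAP §I N2); this file is a TOOL; no mark / label / tier / count moves.

## What

Mazur–Rubin 2007 Prop. 1.3 (i) read at ONE exceptional place `v₀` (memo §9, the cell 118810j1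
reading): for `#Sel_p(E) = p` generated by `c`, `S⁰(E) = 0` iff `loc_{v₀} c` is RAMIFIED, and
`#S⁰(E) = p²` iff it is unramified — the group-currency engine
`ResidualSelmerParityGroupForm.even_and_generatorTest_groupForm` (second conjunct) applied to the
dictionary of PART VIII (`ResidualSelmerParityInstance.exists_groupForm_data`).

* §1 `generatorTest` — both directions at `v₀` with the local term displayed;
  `generatorTest_of_split` — the local term discharged (PART IX) for `v₀` split multiplicative,
  `p ∣ c_{v₀}`.
* §2 `exists_not_mem_residual_of_residualSelmerGroup_eq_bot` — **(G), weak form, FACT-FREE**: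
  `S⁰(E) = ⊥` and `0 ≠ c ∈ Sel_p(E)` ⟹ `loc_v c ∉ Λ_v = H¹_ur` at some `v ∈ T`.

References: [MazurRubin2007] Def. 1.2, Prop. 1.3, Thm. 1.4; [KlagsbrunMazurRubin2013] Thm. 3.9;
HOME/class-closure/N2/P-INSTANCE-ASK-x10g31.md; HOME/X10-AUDIT.md §§35–37.
-/

set_option autoImplicit false

noncomputable section

open scoped Classical

open Function WeierstrassCurve Field Literature.NumberTheory.EllipticCurves
  Literature.NumberTheory.GaloisRepresentations Literature.NumberTheory.GaloisCohomology NumberField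
  IsDedekindDomain
open Literature.NumberTheory.GaloisRepresentations.DiscreteGaloisModule (unramifiedSubgroup SelmerStructure mu)
open Summit.BirchSwinnertonDyer.Rank1Residual.X10.ResidualSelmerGroup
open Summit.BirchSwinnertonDyer.Rank1Residual.X10.ResidualSelmerGroupBinders
open Summit.BirchSwinnertonDyer.Rank1Residual.X10.ResidualSelmerLocalTerm
open Summit.BirchSwinnertonDyer.Rank1Residual.X10.ResidualSelmerParityGroupForm
open Summit.BirchSwinnertonDyer.Rank1Residual.X10.ResidualSelmerGeneratorTestGroupForm
open Summit.BirchSwinnertonDyer.Rank1Residual.X10.ResidualSelmerParityInstance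

namespace Summit.BirchSwinnertonDyer.Rank1Residual.X10.ResidualSelmerGeneratorTestInstance

variable {K : Type} [Field K] [NumberField K] (W : WeierstrassCurve K) [W.IsElliptic] (p : ℕ)
  [hp : Fact p.Prime]

/-! ### §1. The generator tests (G) at a single exceptional place -/

/-- **(G) for `E[p]` at one exceptional place.** Let `S ⊇ {v ∣ ∞} ∪ {v ∣ p} ∪ {bad v}`, `v₀ ∈ S` a
finite place `∤ p` such that every other finite `v ∈ S`, `v ∤ p`, is Tamagawa-`p`-free, with local
term `#𝓛_{v₀} = p · #(𝓛_{v₀} ⊓ H¹_ur)`, and `#Sel_p(E) = p` with `0 ≠ c ∈ Sel_p(E)`. Then: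
`loc_{v₀} c` RAMIFIED ⟹ `S⁰(E) = ⊥`; `loc_{v₀} c` UNRAMIFIED ⟹ `#S⁰(E) = p²`. THE N2 READING: cell
118810j1 (`Sel₃ ≅ ℤ/3` generated by `κ(P)`, `T = {ℓ}`; `κ(P)_ℓ` is unramified iff `P` has an
inertia-fixed cube root in `E(ℚ̄_ℓ)`). [cite: MazurRubin2007, Prop. 1.3 (i) and Thm. 1.4] -/
theorem generatorTest (hp2 : p ≠ 2)
    (hfact : poitouTate_selmerStructure_duality K)
    {S : Finset (Place K)} {v₀ : HeightOneSpectrum (𝓞 K)}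
    (hS : ∀ w : InfinitePlace K, (Sum.inl w : Place K) ∈ S)
    (hSp : ∀ v : HeightOneSpectrum (𝓞 K), (p : 𝓞 K) ∈ v.asIdeal → (Sum.inr v : Place K) ∈ S)
    (hSbad : ∀ v : HeightOneSpectrum (𝓞 K), (Sum.inr v : Place K) ∉ S → W.HasGoodReductionAt v)
    (hv₀ : (Sum.inr v₀ : Place K) ∈ S) (hv₀p : (p : 𝓞 K) ∉ v₀.asIdeal)
    (htam : ∀ v : HeightOneSpectrum (𝓞 K), (Sum.inr v : Place K) ∈ S → v ≠ v₀ →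
      (p : 𝓞 K) ∉ v.asIdeal →
      ¬ p ∣ (W.baseChange (v.adicCompletion K)).localTamagawaNumber (v.adicCompletionIntegers K))
    (hterm : Nat.card (W.kummerSelmerStructure (p : ℤ) (Sum.inr v₀)) =
      p * Nat.card ↥(W.kummerSelmerStructure (p : ℤ) (Sum.inr v₀) ⊓
        unramifiedSubgroup (GaloisRep.toLocal v₀ (W.torsionGaloisModule (p : ℤ))) 1))
    (hcard : Nat.card (W.selmerGroup (p : ℤ)) = p) {c : galH1Torsion W (p : ℤ)}
    (hc : c ∈ W.selmerGroup (p : ℤ)) (hc0 : c ≠ 0) :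
    (galoisCohomology.localization (W.torsionGaloisModule (p : ℤ)) (Sum.inr v₀) 1 c ∉
        unramifiedSubgroup (GaloisRep.toLocal v₀ (W.torsionGaloisModule (p : ℤ))) 1 →
      residualSelmerGroup W p = ⊥) ∧
    (galoisCohomology.localization (W.torsionGaloisModule (p : ℤ)) (Sum.inr v₀) 1 c ∈
        unramifiedSubgroup (GaloisRep.toLocal v₀ (W.torsionGaloisModule (p : ℤ))) 1 →
      Nat.card (residualSelmerGroup W p) = p ^ 2) := by
  haveI : ∀ v : Place K, LocallyCompactSpace (absoluteGaloisGroup (Place.Completion v)) :=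
    fun v => by haveI := absoluteGaloisGroup_compactSpace (Place.Completion v); infer_instance
  haveI : NeZero p := ⟨hp.out.ne_zero⟩
  have hodd' : Odd p := hp.out.odd_of_ne_two hp2
  haveI : ∀ v : Place K, Finite (galoisCohomology ((W.torsionGaloisModule (p : ℤ)).toLocal v) 1) :=
    finite_galoisCohomology_toLocal W p hodd'
  have hΛv₀ := residualSelmerStructure_inr_of_not_mem W p hv₀p
  have hP : ∀ w : InfinitePlace K, (Sum.inl w : Place K) ∈ S.erase (Sum.inr v₀) :=
    fun w => Finset.mem_erase.mpr ⟨Sum.inl_ne_inr, hS w⟩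
  have hPp : ∀ v : HeightOneSpectrum (𝓞 K), (p : 𝓞 K) ∈ v.asIdeal →
      (Sum.inr v : Place K) ∈ S.erase (Sum.inr v₀) :=
    fun v hv => Finset.mem_erase.mpr ⟨fun h => hv₀p (by rw [← Sum.inr_injective h]; exact hv), hSp v hv⟩
  obtain ⟨b, hsymm, hnd, hΛ, hX, hrec, hPT⟩ :=
    exists_groupForm_data W p hp2 hfact hS hSp hSbad hP hPp
  have h := (even_and_generatorTest_groupForm (ι := Place K) hp2
    (Summit.BirchSwinnertonDyer.Rank1Residual.Additive.smul_galH1Torsion_eq_zero W p)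
    (nsmul_galoisCohomology_toLocal_eq_zero W p)
    (fun v => galoisCohomology.localization (W.torsionGaloisModule (p : ℤ)) v 1)
    (residualSelmerStructure W p) b (W.kummerSelmerStructure (p : ℤ)) hsymm hnd hΛ hX hrec hPT
    (finite_residual_outside W p hSp hSbad) subset_rfl (Finset.erase_subset _ _)
    (W.selmerGroup (p : ℤ)) (residualSelmerGroup W p)
    (mem_selmerGroup_iff_of_places W p hS hSp hSbad)
    (mem_residualSelmerGroup_iff_of_places W p (P := S.erase (Sum.inr v₀)) fun v hv hpv =>
      htam v (Finset.mem_erase.mp hv).2 (fun h => (Finset.mem_erase.mp hv).1 (by rw [h])) hpv)).2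
    (Sum.inr v₀) c (Finset.mem_sdiff.mpr ⟨hv₀, fun h => (Finset.mem_erase.mp h).1 rfl⟩)
    (fun v hv hne => by
      obtain ⟨hvS, hvP⟩ := Finset.mem_sdiff.mp hv
      exact absurd (Finset.mem_erase.mpr ⟨hne, hvS⟩) hvP)
    (by rw [hΛv₀]; exact hterm) hcard hc hc0
  exact ⟨fun hcv => h.1 (by rwa [hΛv₀]), fun hcv => h.2 (by rwa [hΛv₀])⟩

/-- **(G) with the local term discharged** (PART IX): `v₀ ∤ p` split multiplicative with
`p ∣ c_{v₀}`. [cite: MazurRubin2007, Prop. 1.3 (i) and Thm. 1.4] -/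
theorem generatorTest_of_split (hp2 : p ≠ 2)
    (hfact : poitouTate_selmerStructure_duality K)
    {S : Finset (Place K)} {v₀ : HeightOneSpectrum (𝓞 K)}
    (hS : ∀ w : InfinitePlace K, (Sum.inl w : Place K) ∈ S)
    (hSp : ∀ v : HeightOneSpectrum (𝓞 K), (p : 𝓞 K) ∈ v.asIdeal → (Sum.inr v : Place K) ∈ S)
    (hSbad : ∀ v : HeightOneSpectrum (𝓞 K), (Sum.inr v : Place K) ∉ S → W.HasGoodReductionAt v)
    (hv₀ : (Sum.inr v₀ : Place K) ∈ S) (hv₀p : (p : 𝓞 K) ∉ v₀.asIdeal)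
    (hv₀split : W.HasSplitMultiplicativeReductionAt v₀)
    (hv₀c : p ∣ (W.baseChange (v₀.adicCompletion K)).localTamagawaNumber (v₀.adicCompletionIntegers K))
    (htam : ∀ v : HeightOneSpectrum (𝓞 K), (Sum.inr v : Place K) ∈ S → v ≠ v₀ →
      (p : 𝓞 K) ∉ v.asIdeal →
      ¬ p ∣ (W.baseChange (v.adicCompletion K)).localTamagawaNumber (v.adicCompletionIntegers K))
    (hcard : Nat.card (W.selmerGroup (p : ℤ)) = p) {c : galH1Torsion W (p : ℤ)}
    (hc : c ∈ W.selmerGroup (p : ℤ)) (hc0 : c ≠ 0) :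
    (galoisCohomology.localization (W.torsionGaloisModule (p : ℤ)) (Sum.inr v₀) 1 c ∉
        unramifiedSubgroup (GaloisRep.toLocal v₀ (W.torsionGaloisModule (p : ℤ))) 1 →
      residualSelmerGroup W p = ⊥) ∧
    (galoisCohomology.localization (W.torsionGaloisModule (p : ℤ)) (Sum.inr v₀) 1 c ∈
        unramifiedSubgroup (GaloisRep.toLocal v₀ (W.torsionGaloisModule (p : ℤ))) 1 →
      Nat.card (residualSelmerGroup W p) = p ^ 2) :=
  generatorTest W p hp2 hfact hS hSp hSbad hv₀ hv₀p htam
    (natCard_kummerLocalConditionAt_eq_mul W v₀ hv₀p hv₀split hv₀c) hcard hc hc0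

/-! ### §2. (G), weak form — FACT-FREE -/

/-- **(G), weak form for `E[p]` (no pairing, no fact).** Let `S ⊇ {v ∣ ∞} ∪ {v ∣ p} ∪ {bad v}` and
`T ⊆ S` finite places `∤ p` with every finite `v ∈ S \ T`, `v ∤ p`, Tamagawa-`p`-free. If
`S⁰(E) = ⊥` then every non-zero `c ∈ Sel_p(E)` is RAMIFIED at some `v ∈ T` (`loc_v c ∉ Λ_v = H¹_ur`).
THE N2 READING (memo (G), `#T_{E′} ≥ 2`): `S⁰ = 0 ⟹ κ(P)` ramified at `≥ 1` prime of `T_{E′}`.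
[cite: MazurRubin2007, Def. 1.2] -/
theorem exists_not_mem_residual_of_residualSelmerGroup_eq_bot
    {S T : Finset (Place K)} (hS : ∀ w : InfinitePlace K, (Sum.inl w : Place K) ∈ S)
    (hSp : ∀ v : HeightOneSpectrum (𝓞 K), (p : 𝓞 K) ∈ v.asIdeal → (Sum.inr v : Place K) ∈ S)
    (hSbad : ∀ v : HeightOneSpectrum (𝓞 K), (Sum.inr v : Place K) ∉ S → W.HasGoodReductionAt v)
    (htam : ∀ v : HeightOneSpectrum (𝓞 K), (Sum.inr v : Place K) ∈ S → (Sum.inr v : Place K) ∉ T →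
      (p : 𝓞 K) ∉ v.asIdeal →
      ¬ p ∣ (W.baseChange (v.adicCompletion K)).localTamagawaNumber (v.adicCompletionIntegers K))
    (hbot : residualSelmerGroup W p = ⊥) {c : galH1Torsion W (p : ℤ)}
    (hc : c ∈ W.selmerGroup (p : ℤ)) (hc0 : c ≠ 0) :
    ∃ v ∈ T, galoisCohomology.localization (W.torsionGaloisModule (p : ℤ)) v 1 c ∉
      residualSelmerStructure W p v := by
  have hkey : ∀ v ∈ S \ (S \ T), v ∉ T →
      W.kummerSelmerStructure (p : ℤ) v = residualSelmerStructure W p v := by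
    intro v hv hvT
    obtain ⟨hvS, hvP⟩ := Finset.mem_sdiff.mp hv
    exact absurd (Finset.mem_sdiff.mpr ⟨hvS, hvT⟩) hvP
  exact exists_not_mem_of_eq_bot_groupForm
    (fun v => galoisCohomology.localization (W.torsionGaloisModule (p : ℤ)) v 1)
    (residualSelmerStructure W p) (W.kummerSelmerStructure (p : ℤ)) hkey
    (W.selmerGroup (p : ℤ)) (residualSelmerGroup W p)
    (mem_selmerGroup_iff_of_places W p hS hSp hSbad)
    (mem_residualSelmerGroup_iff_of_places W p (P := S \ T) fun v hv hpv =>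
      htam v (Finset.mem_sdiff.mp hv).1 (Finset.mem_sdiff.mp hv).2 hpv)
    Finset.sdiff_subset hbot hc hc0

end Summit.BirchSwinnertonDyer.Rank1Residual.X10.ResidualSelmerGeneratorTestInstance

end
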